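import Summits.KontsevichZagierPeriods.Zeta5Search.WellPoisedFaceTailPhi
import HarnessLib

/-!
# Odd-zeta search — [Zudilin2004, Lemma 19] on the numerator-free face, part 11a: the LIVE WINDOW by parity
# (every number of tail bricks `B = M + 2 ≥ 3`; cell `pub-zeta5`, fam-vwp gen 9)

HONEST FRAMING: systematic search; no irrationality claim unless certified.

Files 9a/9b/10 (`WellPoisedFaceTailLaiData` / `WellPoisedFaceTailWindows` / `WellPoisedFaceTailPhi`, fam-vwp gen 8)
proved Lemma 19 with its SHARP denominator `D(n) = D_{M₁}³ D_{M₂} ⋯ D_{M_{M+2}}` and the `Φ(h_n)⁻¹` saving for an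
integral face direction `E : IntFaceDir M` (`q = M + 5`, `B = M + 2` tail bricks, heads `h₁ = h₂ = h₃ = 1`) under two
bookkeeping hypotheses: `M` EVEN (the boxes `q = 9, 11, …`, window `{ζ(5), ζ(7), …, ζ(M+3)}`) and `Monotone E.tail`
(tails listed increasingly).  This part removes the first, part 11b (`WellPoisedFaceTailGeneral`) the second.

* `liveWindow B N = {s : 3 < s ≤ B + 2, B(N+1) + s odd}` — the weights that survive the well-poised reflection at the
  ray member with `η₀ n = N` (fam-odd's parity rule = `WellPoisedFaceTailLinearForms.tail_sum_vanish`: the order-`o`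
  coefficient vanishes when `B(η₀n+1) + o` is odd; the same window as fam-odd 15's `tailF_linearForm_parity`, which
  has rational coefficients and the frame denominator `D_{η₀n}^{B+2}`); `sum_liveWindow_eq`; it is the ODD window
  `{5, 7, …}` when `B` is even or `η₀ n` is odd (`liveWindow_of_even`, `liveWindow_of_oddMul`) and the EVEN window
  `{4, 6, …, B+1}` when `B` is odd and `η₀ n` even (`liveWindow_of_odd_even`).
* `tailF_comp_perm`, `PhiQ_comp_perm`: `F(h)` [(8.6)] and `Φ(h)` [(8.9)] are SYMMETRIC functions of the tail bricks
  (used by part 11b to sort the tails).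
* `IntFaceDir.faceD_mul_tailF_mem_live` (every `n`) and `IntFaceDir.faceLambda_tailF_mem_live` (`(M+1)² ≤ η₀n + 2`):
  the theorems of files 9b/10 with the live window in place of the odd one — EVERY `M ≥ 1`, sorted tails:
  `D(n)·F(h_n)`, resp. `Λ_n = D(n)·Φ(h_n)⁻¹·F(h_n)`, equals `Σ_{s ∈ liveWindow (M+2) (η₀n)} a_s ζ(s) − b`, `a_s, b ∈ ℤ`
  (proofs verbatim, the parity hypothesis of `tail_sum_vanish` fed through).

## What is NOT proved here
Anything about any `ζ(s)` (the forms grow: `WellPoisedFaceOddGrowthFree`); unsorted tails (part 11b).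

References: [Zudilin2004, Lemma 19, (8.6)–(8.10)]; [BallRivoal2001]; [Rivoal2000, Lemme 1].
-/
noncomputable section

open Finset Filter

/-! ## 1. The live window and the symmetry of `F` in the tails -/

namespace Summit.KontsevichZagierPeriods.Zeta5Search.WellPoisedFaceRate

open Literature.NumberTheory.Transcendental (zetaValue)

variable {B : ℕ}

/-- The LIVE WINDOW of weights on a `B`-brick face at the ray member with `η₀ n = N`:
`{s : 3 < s ≤ B + 2, B(N+1) + s odd}` (the order `o = s − 3` survives `tail_sum_vanish` iff `B(N+1) + o` is even). -/
def liveWindow (B N : ℕ) : Finset ℕ := (Ioc 3 (B + 2)).filter (fun s => Odd (B * (N + 1) + s))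

/-- Dropping the vanishing orders (`o = 0` and `K + o` odd) and reindexing `s = o + 3`:
`Σ_{o<B} g_o ζ(o+3) = Σ_{3<s≤B+2, K+s odd} g_{s−3} ζ(s)`. -/
theorem sum_parityWindow_eq (K : ℕ) (g : ℕ → ℚ) (h0 : g 0 = 0) (hpar : ∀ o, o < B → Odd (K + o) → g o = 0) :
    ∑ o ∈ range B, (g o : ℝ) * zetaValue (o + 3)
      = ∑ s ∈ (Ioc 3 (B + 2)).filter (fun s => Odd (K + s)), (g (s - 3) : ℝ) * zetaValue s := by
  have hre : ∑ s ∈ Ico 3 (B + 3), (g (s - 3) : ℝ) * zetaValue s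
      = ∑ o ∈ range B, (g o : ℝ) * zetaValue (o + 3) := by
    rw [Finset.sum_Ico_eq_sum_range, Nat.add_sub_cancel]
    refine sum_congr rfl fun o _ => ?_
    rw [Nat.add_sub_cancel_left, add_comm 3 o]
  have hsub : (Ioc 3 (B + 2)).filter (fun s => Odd (K + s)) ⊆ Ico 3 (B + 3) := by
    intro x hx
    rw [mem_filter, mem_Ioc] at hx
    rw [mem_Ico]
    omega
  have hvan : ∀ x ∈ Ico 3 (B + 3), x ∉ (Ioc 3 (B + 2)).filter (fun s => Odd (K + s)) →
      (g (x - 3) : ℝ) * zetaValue x = 0 := by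
    intro x hx hx'
    rw [mem_Ico] at hx
    rw [mem_filter, mem_Ioc] at hx'
    by_cases h3 : x = 3
    · subst h3
      rw [Nat.sub_self, h0, Rat.cast_zero, zero_mul]
    · have hev : ¬Odd (K + x) := fun hodd => hx' ⟨⟨by omega, by omega⟩, hodd⟩
      have hodd : Odd (K + (x - 3)) := by
        rw [Nat.not_odd_iff_even, Nat.even_iff] at hev
        rw [Nat.odd_iff]
        omega
      rw [hpar (x - 3) (by omega) hodd, Rat.cast_zero, zero_mul]
  rw [← hre, Finset.sum_subset hsub hvan]

/-- The same over the live window of a `B`-brick face (`K = B(N+1)`). -/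
theorem sum_liveWindow_eq (N : ℕ) (g : ℕ → ℚ) (h0 : g 0 = 0)
    (hpar : ∀ o, o < B → Odd (B * (N + 1) + o) → g o = 0) :
    ∑ o ∈ range B, (g o : ℝ) * zetaValue (o + 3) = ∑ s ∈ liveWindow B N, (g (s - 3) : ℝ) * zetaValue s :=
  sum_parityWindow_eq (B * (N + 1)) g h0 hpar

/-- `B(N+1)` even ⇒ the live window is the ODD window `{5, 7, …}`. -/
theorem liveWindow_of_even_mul {N : ℕ} (h : Even (B * (N + 1))) : liveWindow B N = (Ioc 3 (B + 2)).filter Odd := by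
  unfold liveWindow
  exact Finset.filter_congr fun s _ => by
    rw [Nat.odd_add']
    exact ⟨fun h' => h'.mpr h, fun h' => ⟨fun _ => h, fun _ => h'⟩⟩

/-- `B(N+1)` odd ⇒ the live window is the EVEN window `{4, 6, …}`. -/
theorem liveWindow_of_odd_mul {N : ℕ} (h : Odd (B * (N + 1))) : liveWindow B N = (Ioc 3 (B + 2)).filter Even := by
  unfold liveWindow
  exact Finset.filter_congr fun s _ => by
    rw [Nat.odd_add]
    exact ⟨fun h' => h'.mp h, fun h' => ⟨fun _ => h', fun _ => h⟩⟩

/-- Even `B` (the boxes `q = B + 3 = 7, 9, 11, …`): the odd window, every `n`. -/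
theorem liveWindow_of_even (hB : Even B) (N : ℕ) : liveWindow B N = (Ioc 3 (B + 2)).filter Odd :=
  liveWindow_of_even_mul (hB.mul_right _)

/-- `η₀ n` odd (`h₀` odd): the odd window, whatever `B`. -/
theorem liveWindow_of_oddMul {N : ℕ} (hN : Odd N) : liveWindow B N = (Ioc 3 (B + 2)).filter Odd :=
  liveWindow_of_even_mul (hN.add_one.mul_left _)

/-- Odd `B` (`q` even) and `η₀ n` even: the EVEN window — the odd zeta values drop out. -/
theorem liveWindow_of_odd_even (hB : Odd B) {N : ℕ} (hN : Even N) : liveWindow B N = (Ioc 3 (B + 2)).filter Even :=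
  liveWindow_of_odd_mul (hB.mul hN.add_one)

/-- `R(t)` [(8.7)·(h₀ + 2t)] is a symmetric function of the tail bricks. -/
theorem tailR_comp_perm (η₀ : ℕ) (η : Fin B → ℕ) (n : ℕ) (σ : Equiv.Perm (Fin B)) :
    tailR η₀ (η ∘ σ) n = tailR η₀ η n := by
  funext t
  unfold tailR
  simp only [Function.comp_apply]
  congr 1
  exact Fintype.prod_equiv σ _ _ fun j => rfl

/-- `F(h) = ½ Σ_t R″(t)` is a symmetric function of the tail bricks. -/
theorem tailF_comp_perm (η₀ : ℕ) (η : Fin B → ℕ) (n : ℕ) (σ : Equiv.Perm (Fin B)) :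
    tailF η₀ (η ∘ σ) n = tailF η₀ η n := by
  unfold tailF
  rw [tailR_comp_perm]

end Summit.KontsevichZagierPeriods.Zeta5Search.WellPoisedFaceRate

/-! ## 2. `Φ(h)` [(8.9)] is symmetric in the tail bricks -/

namespace Summit.KontsevichZagierPeriods.Zeta5Search.WellPoisedFace

/-- `ν_{k,p}(h)` [(8.8)] is unchanged by permuting the tail bricks. -/
theorem nuKPq_comp_perm (h0 h1 h2 h3 : ℤ) {B : ℕ} (h : Fin B → ℤ) (σ : Equiv.Perm (Fin B)) (k p : ℤ) :
    nuKPq h0 h1 h2 h3 (h ∘ σ) k p = nuKPq h0 h1 h2 h3 h k p := by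
  unfold nuKPq
  simp only [Function.comp_apply]
  congr 1
  exact Fintype.sum_equiv σ _ _ fun j => rfl

/-- `ν_p(h)` is unchanged by permuting the tail bricks. -/
theorem nuPq_comp_perm (h0 h1 h2 h3 : ℤ) {B : ℕ} (h : Fin B → ℤ) (σ : Equiv.Perm (Fin B)) (kLo p : ℤ) :
    nuPq h0 h1 h2 h3 (h ∘ σ) kLo p = nuPq h0 h1 h2 h3 h kLo p := by
  unfold nuPq
  simp only [nuKPq_comp_perm]

/-- **`Φ(h)` [(8.9)] is unchanged by permuting the tail bricks.** -/
theorem PhiQ_comp_perm (h0 h1 h2 h3 : ℤ) {B : ℕ} (h : Fin B → ℤ) (σ : Equiv.Perm (Fin B)) (kLo m : ℤ) :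
    PhiQ h0 h1 h2 h3 (h ∘ σ) kLo m = PhiQ h0 h1 h2 h3 h kLo m := by
  unfold PhiQ
  simp only [nuPq_comp_perm]

end Summit.KontsevichZagierPeriods.Zeta5Search.WellPoisedFace

/-! ## 3. Lemma 19 with the live window (sorted tails, every `M ≥ 1`) -/

namespace Summit.KontsevichZagierPeriods.Zeta5Search.WellPoisedFace.IntFaceDir

open Literature.NumberTheory.Transcendental (zetaValue)
open Summit.KontsevichZagierPeriods.Zeta5Search.WellPoisedFaceRate (tailF tailCoef tailConst laiTailData
  exists_laiTailData tailDataOf tailRQ_eq_pfEval tailF_eq_coef tail_sum_order_zero tail_sum_vanish liveWindow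
  sum_liveWindow_eq)

variable {M : ℕ} (E : IntFaceDir M) (n : ℕ)

/-- **Lemma 19's sharp denominator, live window** (file 9b's `faceD_mul_tailF_mem` for every parity of `M`):
for sorted tails, `M ≥ 1` and every `n`, `D(n) · F(h_n) = Σ_{s ∈ liveWindow (M+2) (η₀n)} a_s ζ(s) − b`, `a_s, b ∈ ℤ`. -/
theorem faceD_mul_tailF_mem_live (hs : Monotone E.tail) (hM1 : 1 ≤ M) (n : ℕ) :
    ∃ a : ℕ → ℤ, ∃ b : ℤ, (E.faceD n : ℝ) * tailF E.η₀ E.tail n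
      = (∑ s ∈ liveWindow (M + 2) (E.η₀ * n), (a s : ℝ) * zetaValue s) - (b : ℝ) := by
  have hη := E.two_tail_lt
  have hB : 3 ≤ M + 2 := by omega
  obtain ⟨c, hc⟩ := exists_laiTailData E.η₀ E.tail n hB hη
  have hc' := tailRQ_eq_pfEval E.η₀ E.tail n hη hc
  have hF := tailF_eq_coef hB hη hc'
  have h0 : tailCoef (E.η₀ * n) (tailDataOf E.η₀ E.tail n c) 0 = 0 := by
    rw [tailCoef, tail_sum_order_zero hB hη hc', mul_zero]
  have hdead : ∀ o, o < M + 2 → Odd ((M + 2) * (E.η₀ * n + 1) + o) →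
      tailCoef (E.η₀ * n) (tailDataOf E.η₀ E.tail n c) o = 0 := by
    intro o ho hoo
    rw [tailCoef, tail_sum_vanish hB hη hc' o ho hoo, mul_zero]
  choose za hza using fun o => E.facePi_mul_tailCoef n hs hc o
  obtain ⟨zb, hzb⟩ := E.facePi_mul_tailConst n hs hc
  refine ⟨fun s => za (s - 3), zb, ?_⟩
  have hD : (E.faceD n : ℝ) = ((E.facePi n : ℕ) : ℝ) := by rw [E.faceD_eq_facePi]
  have eb : ((E.facePi n : ℕ) : ℝ) * (tailConst (E.η₀ * n) (M + 2) (tailDataOf E.η₀ E.tail n c) : ℝ)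
      = (zb : ℝ) := by
    have := congrArg (fun q : ℚ => (q : ℝ)) hzb
    push_cast at this
    exact this
  have hw : ∑ o ∈ range (M + 2), ((((E.facePi n : ℕ) : ℚ) * tailCoef (E.η₀ * n) (tailDataOf E.η₀ E.tail n c) o
        : ℚ) : ℝ) * zetaValue (o + 3)
      = ∑ s ∈ liveWindow (M + 2) (E.η₀ * n), ((((E.facePi n : ℕ) : ℚ)
          * tailCoef (E.η₀ * n) (tailDataOf E.η₀ E.tail n c) (s - 3) : ℚ) : ℝ) * zetaValue s :=
    sum_liveWindow_eq (E.η₀ * n)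
      (fun o => ((E.facePi n : ℕ) : ℚ) * tailCoef (E.η₀ * n) (tailDataOf E.η₀ E.tail n c) o)
      (by rw [h0, mul_zero]) (fun o ho hoo => by rw [hdead o ho hoo, mul_zero])
  beta_reduce
  rw [hD, hF, mul_sub, eb, mul_sum]
  congr 1
  calc ∑ o ∈ range (M + 2), ((E.facePi n : ℕ) : ℝ)
        * ((tailCoef (E.η₀ * n) (tailDataOf E.η₀ E.tail n c) o : ℝ) * zetaValue (o + 3))
      = ∑ o ∈ range (M + 2), ((((E.facePi n : ℕ) : ℚ) * tailCoef (E.η₀ * n) (tailDataOf E.η₀ E.tail n c) o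
          : ℚ) : ℝ) * zetaValue (o + 3) := by
        refine sum_congr rfl fun o _ => ?_
        push_cast
        ring
    _ = _ := hw
    _ = ∑ s ∈ liveWindow (M + 2) (E.η₀ * n), (za (s - 3) : ℝ) * zetaValue s := by
        refine sum_congr rfl fun s _ => ?_
        rw [hza (s - 3)]
        norm_cast

/-- **[Zudilin2004, Lemma 19], live window** (file 10's `faceLambda_tailF_mem` for every parity of `M`): for sorted
tails, `M ≥ 1` and `(M+1)² ≤ η₀ n + 2`, `Λ_n = D(n)Φ(h_n)⁻¹F(h_n) = Σ_{s ∈ liveWindow (M+2) (η₀n)} a_s ζ(s) − b`,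
`a_s, b ∈ ℤ`.  (The forms grow; NOT evidence about any of these numbers.) -/
theorem faceLambda_tailF_mem_live (hs : Monotone E.tail) (hM1 : 1 ≤ M) (hn : (M + 1) ^ 2 ≤ E.η₀ * n + 2) :
    ∃ a : ℕ → ℤ, ∃ b : ℤ, E.faceLambda (tailF E.η₀ E.tail) n
      = (∑ s ∈ liveWindow (M + 2) (E.η₀ * n), (a s : ℝ) * zetaValue s) - (b : ℝ) := by
  have hη := E.two_tail_lt
  have hB : 3 ≤ M + 2 := by omega
  obtain ⟨c, hc⟩ := exists_laiTailData E.η₀ E.tail n hB hη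
  have hc' := tailRQ_eq_pfEval E.η₀ E.tail n hη hc
  have hF := tailF_eq_coef hB hη hc'
  have h0 : tailCoef (E.η₀ * n) (tailDataOf E.η₀ E.tail n c) 0 = 0 := by
    rw [tailCoef, tail_sum_order_zero hB hη hc', mul_zero]
  have hdead : ∀ o, o < M + 2 → Odd ((M + 2) * (E.η₀ * n + 1) + o) →
      tailCoef (E.η₀ * n) (tailDataOf E.η₀ E.tail n c) o = 0 := by
    intro o ho hoo
    rw [tailCoef, tail_sum_vanish hB hη hc' o ho hoo, mul_zero]
  have hA : ∀ o, ∃ z : ℤ, ((E.facePi n : ℕ) : ℚ) * tailCoef (E.η₀ * n) (tailDataOf E.η₀ E.tail n c) o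
      / (E.facePhi n : ℚ) = (z : ℚ) := fun o =>
    E.exists_int_div_facePhi n (E.facePi_mul_tailCoef n hs hc o)
      fun p hp => E.padicOrdGe_facePi_tailCoef n hs hn hc hp o
  choose za hza using hA
  obtain ⟨zb, hzb⟩ := E.exists_int_div_facePhi n (E.facePi_mul_tailConst n hs hc)
    fun p hp => E.padicOrdGe_facePi_tailConst n hs hn hc hp
  refine ⟨fun s => za (s - 3), zb, ?_⟩
  have hD : (E.faceD n : ℝ) = ((E.facePi n : ℕ) : ℝ) := by rw [E.faceD_eq_facePi]
  have eb : ((E.facePi n : ℕ) : ℝ) / (E.facePhi n : ℝ)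
      * (tailConst (E.η₀ * n) (M + 2) (tailDataOf E.η₀ E.tail n c) : ℝ) = (zb : ℝ) := by
    have := congrArg (fun q : ℚ => (q : ℝ)) hzb
    push_cast at this
    rw [← this]; ring
  have hw : ∑ o ∈ range (M + 2), ((((E.facePi n : ℕ) : ℚ) * tailCoef (E.η₀ * n) (tailDataOf E.η₀ E.tail n c) o
        / (E.facePhi n : ℚ) : ℚ) : ℝ) * zetaValue (o + 3)
      = ∑ s ∈ liveWindow (M + 2) (E.η₀ * n), ((((E.facePi n : ℕ) : ℚ)
          * tailCoef (E.η₀ * n) (tailDataOf E.η₀ E.tail n c) (s - 3) / (E.facePhi n : ℚ) : ℚ) : ℝ)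
          * zetaValue s :=
    sum_liveWindow_eq (E.η₀ * n)
      (fun o => ((E.facePi n : ℕ) : ℚ) * tailCoef (E.η₀ * n) (tailDataOf E.η₀ E.tail n c) o
        / (E.facePhi n : ℚ))
      (by rw [h0, mul_zero, zero_div]) (fun o ho hoo => by rw [hdead o ho hoo, mul_zero, zero_div])
  beta_reduce
  rw [faceLambda, hD, hF, mul_sub, eb, mul_sum]
  congr 1
  calc ∑ o ∈ range (M + 2), ((E.facePi n : ℕ) : ℝ) / (E.facePhi n : ℝ)
        * ((tailCoef (E.η₀ * n) (tailDataOf E.η₀ E.tail n c) o : ℝ) * zetaValue (o + 3))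
      = ∑ o ∈ range (M + 2), ((((E.facePi n : ℕ) : ℚ) * tailCoef (E.η₀ * n) (tailDataOf E.η₀ E.tail n c) o
          / (E.facePhi n : ℚ) : ℚ) : ℝ) * zetaValue (o + 3) := by
        refine sum_congr rfl fun o _ => ?_
        push_cast
        ring
    _ = _ := hw
    _ = ∑ s ∈ liveWindow (M + 2) (E.η₀ * n), (za (s - 3) : ℝ) * zetaValue s := by
        refine sum_congr rfl fun s _ => ?_
        rw [hza (s - 3)]
        norm_cast

end Summit.KontsevichZagierPeriods.Zeta5Search.WellPoisedFace.IntFaceDir
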